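import Mathlib
import HarnessLib
import Summits.NavierStokesRegularity.NavierStokesRegularity.Theorems.PoloidalWindowDoorLrcModEntireTwistingTHOscUniversalWeightPieces

/-!
# Item `LrcModEntire` (stmt-NavierStokesRegularity-20428), CLASS road — the explicit universal Lyapunov weight for (OSC), part 2/3: GLUING
# (`C²` via two primitives of a continuous even profile; evenness; identification with the closed forms on `[0,A]` and `[A,∞)`)

Cell ns-regularity-ideate, LEAD ns-poloidal-K2-p3 g13 (`--supports stmt-NavierStokesRegularity-20428`; sequel of `…OscUniversalWeightPieces`, see there and in
part 3 `…OscUniversalWeight` for the statement and the reading).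

WHAT THIS IS NOT: not a claim about Navier–Stokes regularity and not the stub — one-variable real analysis (bears_on LADDER-NS N0, item 20428 / crux 19708;
both OPEN).
-/

noncomputable section

-- the summit and its single sub-problem share the name (CONVENTIONS §1), as in every Theorems file
set_option linter.dupNamespace false

namespace Summit.NavierStokesRegularity.NavierStokesRegularity.Theorems.PoloidalWindowDoorLrcModEntireTwistingTHOscUniversalWeightGlue

open Set Filter Topology MeasureTheory intervalIntegral
open Summit.NavierStokesRegularity.NavierStokesRegularity.Theorems.PoloidalWindowDoorLrcModEntireTwistingTHOscUniversalWeightDefs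
open Summit.NavierStokesRegularity.NavierStokesRegularity.Theorems.PoloidalWindowDoorLrcModEntireTwistingTHOscUniversalWeightPieces

variable {A : ℝ}

/-! ### Continuity of the second-derivative profile; the weight is `C²` -/

/-- `gL` is continuous. -/
theorem continuous_gL : Continuous (gL A) := by unfold gL; fun_prop

/-- `w_R` is continuous. -/
theorem continuous_wR : Continuous (wR A) := by unfold wR qf; fun_prop

/-- `wR2` is continuous. -/
theorem continuous_wR2 : Continuous (wR2 A) := by
  unfold wR2
  exact (by fun_prop : Continuous fun ξ : ℝ => (lam A + 2 * kap A * (ξ - A)) ^ 2 - 2 * kap A).mul continuous_wR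

/-- The glued profile `G` is continuous (values match at `A`). -/
theorem continuous_Gf (hA : 0 < A) : Continuous (Gf A) := by
  unfold Gf
  refine Continuous.if_le continuous_gL continuous_wR2 continuous_id continuous_const ?_
  intro x hx
  rw [hx, wR2_at hA]

/-- `g = G ∘ |·|` is continuous. -/
theorem continuous_gf (hA : 0 < A) : Continuous (gf A) := by
  unfold gf; exact (continuous_Gf hA).comp continuous_abs

/-- FTC: `w₁′ = g`. -/
theorem hasDerivAt_w1 (hA : 0 < A) (ξ : ℝ) : HasDerivAt (w1 A) (gf A ξ) ξ :=
  ((continuous_gf hA).integral_hasStrictDerivAt 0 ξ).hasDerivAt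

/-- `w₁` is continuous. -/
theorem continuous_w1 (hA : 0 < A) : Continuous (w1 A) :=
  continuous_iff_continuousAt.2 fun ξ => (hasDerivAt_w1 hA ξ).continuousAt

/-- FTC: `w′ = w₁`. -/
theorem hasDerivAt_wf (hA : 0 < A) (ξ : ℝ) : HasDerivAt (wf A) (w1 A ξ) ξ := by
  have h := ((continuous_w1 hA).integral_hasStrictDerivAt 0 ξ).hasDerivAt
  exact h.const_add 1

/-- `deriv w = w₁`. -/
theorem deriv_wf (hA : 0 < A) : deriv (wf A) = w1 A := funext fun ξ => (hasDerivAt_wf hA ξ).deriv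

/-- `deriv w₁ = g`. -/
theorem deriv_w1 (hA : 0 < A) : deriv (w1 A) = gf A := funext fun ξ => (hasDerivAt_w1 hA ξ).deriv

/-- **The weight is `C²`** (twice a primitive of a continuous function). -/
theorem contDiff_two_wf (hA : 0 < A) : ContDiff ℝ 2 (wf A) := by
  rw [show (2 : WithTop ℕ∞) = (1 : WithTop ℕ∞) + 1 from rfl, contDiff_succ_iff_deriv]
  refine ⟨fun ξ => (hasDerivAt_wf hA ξ).differentiableAt, by simp, ?_⟩
  rw [deriv_wf hA, show (1 : WithTop ℕ∞) = (0 : WithTop ℕ∞) + 1 from rfl, contDiff_succ_iff_deriv]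
  refine ⟨fun ξ => (hasDerivAt_w1 hA ξ).differentiableAt, by simp, ?_⟩
  rw [deriv_w1 hA]
  exact contDiff_zero.2 (continuous_gf hA)

/-! ### Evenness -/

/-- `g` is even. -/
theorem gf_even (ξ : ℝ) : gf A (-ξ) = gf A ξ := by unfold gf; rw [abs_neg]

/-- `w₁` is odd. -/
theorem w1_odd (ξ : ℝ) : w1 A (-ξ) = -w1 A ξ := by
  unfold w1
  have h : (∫ s in (0 : ℝ)..ξ, gf A (-s)) = ∫ s in (-ξ)..(-0 : ℝ), gf A s := integral_comp_neg _
  simp only [gf_even, neg_zero] at h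
  rw [h, integral_symm]

/-- **The weight is even.** -/
theorem wf_even (ξ : ℝ) : wf A (-ξ) = wf A ξ := by
  unfold PoloidalWindowDoorLrcModEntireTwistingTHOscUniversalWeightDefs.wf
  have h : (∫ s in (0 : ℝ)..ξ, w1 A (-s)) = ∫ s in (-ξ)..(-0 : ℝ), w1 A s := integral_comp_neg _
  have h2 : (∫ s in (0 : ℝ)..ξ, w1 A (-s)) = -∫ s in (0 : ℝ)..ξ, w1 A s := by
    simp_rw [w1_odd (A := A)]
    exact intervalIntegral.integral_neg
  rw [h2, neg_zero] at h
  rw [intervalIntegral.integral_symm (0 : ℝ) (-ξ)] at h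
  have h3 : (∫ s in (0 : ℝ)..(-ξ), w1 A s) = ∫ s in (0 : ℝ)..ξ, w1 A s := by linarith
  rw [h3]

/-! ### Identification with the closed forms on `[0, A]` and on `[A, ∞)` -/

/-- On `[0,A]`, `g = gL`. -/
theorem gf_of_mem {s : ℝ} (hs0 : 0 ≤ s) (hsA : s ≤ A) : gf A s = gL A s := by
  unfold gf Gf; rw [abs_of_nonneg hs0, if_pos hsA]

/-- On `[A,∞)`, `g = wR2`. -/
theorem gf_of_ge (hA : 0 < A) {s : ℝ} (hsA : A ≤ s) : gf A s = wR2 A s := by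
  unfold gf Gf
  rw [abs_of_nonneg (hA.le.trans hsA)]
  by_cases h : s ≤ A
  · rw [if_pos h, le_antisymm h hsA, wR2_at hA]
  · rw [if_neg h]

/-- On `[0,A]`, `w₁ = −γh` (FTC-2). -/
theorem w1_of_mem (hA : 0 < A) {ξ : ℝ} (hξ0 : 0 ≤ ξ) (hξA : ξ ≤ A) : w1 A ξ = -gam A * hf A ξ := by
  unfold w1
  have h1 : (∫ s in (0 : ℝ)..ξ, gf A s) = ∫ s in (0 : ℝ)..ξ, gL A s := by
    refine integral_congr fun s hs => ?_
    rw [uIcc_of_le hξ0] at hs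
    exact gf_of_mem hs.1 (hs.2.trans hξA)
  rw [h1, integral_eq_sub_of_hasDerivAt (fun s _ => hasDerivAt_wL1 hA s) (continuous_gL.intervalIntegrable _ _)]
  unfold hf; simp

/-- **On `[0,A]`, `w = w_L = 1 − γH`** (FTC-2). -/
theorem wf_of_mem (hA : 0 < A) {ξ : ℝ} (hξ0 : 0 ≤ ξ) (hξA : ξ ≤ A) : wf A ξ = wL A ξ := by
  unfold PoloidalWindowDoorLrcModEntireTwistingTHOscUniversalWeightDefs.wf
  have h1 : (∫ s in (0 : ℝ)..ξ, w1 A s) = ∫ s in (0 : ℝ)..ξ, -gam A * hf A s := by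
    refine integral_congr fun s hs => ?_
    rw [uIcc_of_le hξ0] at hs
    exact w1_of_mem hA hs.1 (hs.2.trans hξA)
  have hcont : Continuous fun s => -gam A * hf A s := by unfold hf; fun_prop
  rw [h1, integral_eq_sub_of_hasDerivAt (fun s _ => hasDerivAt_wL hA s) (hcont.intervalIntegrable _ _)]
  unfold wL Hf; simp; ring

/-- On `[A,∞)`, `w₁ = w_R′` (FTC-2 across the glue point). -/
theorem w1_of_ge (hA : 0 < A) {ξ : ℝ} (hξA : A ≤ ξ) : w1 A ξ = wR1 A ξ := by
  have hξ0 : 0 ≤ ξ := hA.le.trans hξA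
  have hsplit : w1 A ξ = w1 A A + ∫ s in A..ξ, gf A s := by
    unfold w1
    rw [← integral_add_adjacent_intervals ((continuous_gf hA).intervalIntegrable 0 A)
      ((continuous_gf hA).intervalIntegrable A ξ)]
  have h1 : (∫ s in A..ξ, gf A s) = ∫ s in A..ξ, wR2 A s := by
    refine integral_congr fun s hs => ?_
    rw [uIcc_of_le hξA] at hs
    exact gf_of_ge hA hs.1
  rw [hsplit, h1, w1_of_mem hA hA.le le_rfl,
    integral_eq_sub_of_hasDerivAt (fun s _ => hasDerivAt_wR1 (A := A) s) (continuous_wR2.intervalIntegrable _ _),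
    wR1_at hA]
  ring

/-- `wR1` is continuous. -/
theorem continuous_wR1 : Continuous (wR1 A) := by
  unfold wR1
  exact (by fun_prop : Continuous fun ξ : ℝ => -(lam A + 2 * kap A * (ξ - A))).mul continuous_wR

/-- **On `[A,∞)`, `w = w_R`** (FTC-2 across the glue point). -/
theorem wf_of_ge (hA : 0 < A) {ξ : ℝ} (hξA : A ≤ ξ) : wf A ξ = wR A ξ := by
  have hsplit : wf A ξ = wf A A + ∫ s in A..ξ, w1 A s := by
    unfold PoloidalWindowDoorLrcModEntireTwistingTHOscUniversalWeightDefs.wf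
    rw [← integral_add_adjacent_intervals ((continuous_w1 hA).intervalIntegrable 0 A)
      ((continuous_w1 hA).intervalIntegrable A ξ)]
    ring
  have h1 : (∫ s in A..ξ, w1 A s) = ∫ s in A..ξ, wR1 A s := by
    refine integral_congr fun s hs => ?_
    rw [uIcc_of_le hξA] at hs
    exact w1_of_ge hA hs.1
  rw [hsplit, h1, wf_of_mem hA hA.le le_rfl,
    integral_eq_sub_of_hasDerivAt (fun s _ => hasDerivAt_wR (A := A) s) (continuous_wR1.intervalIntegrable _ _),
    wR_at]
  unfold WA; ring

end Summit.NavierStokesRegularity.NavierStokesRegularity.Theorems.PoloidalWindowDoorLrcModEntireTwistingTHOscUniversalWeightGlue
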